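/-
Copyright (c) 2026 the pub-hodgecm-mathlib formalisation cell (harness21).  Prover seat hodgecm-mathlib-K2E3-p12 (g6): Track B «K2-LIT», ENGINE E1 (on loan
per chair word «β → E1»), h413 = stmt-HodgeConjecture-24833; campaign «EIS-WHITTAKER-2», letter «W-hWbd» (K2E1-plan (g4) deal 07:52:48Z, FINAL RULING g4 «W5 DIVISION» 07:56:16Z:
this seat owns files A + C), FILE C1 of the assembly: the local packages sharpened off `S_δ` and merged into ONE per-place package.
-/
import Summits.HodgeConjecture.HodgeConjecture.Theorems.K2E1LocalWhittakerContinuationU2     -- ★ p858451 FILE A (this seat): the η-uniform entire package at one place, unramified value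
import HarnessLib

/-!
# K2·E1 — `K2E1LocalWhittakerPackageU2` («EIS-WHITTAKER-2», letter «W-hWbd», FILE C1): ONE ENTIRE PACKAGE PER FINITE PLACE WITH THE SHARP BOUND `B_v·2(n+1)`, `B_v = 1` OFF `S_δ`

Track B ∕ K2-LIT, crux h413 = `stmt-HodgeConjecture-24833`, route of record `HCCMUnconditional`; cell `hodgecm-mathlib`, squad K2, ENGINE E1.  THEOREMS ONLY (no `def`, no instance, no notation,
no named-fact hypothesis, no `sorry`; default heartbeats); lane `--supports stmt-HodgeConjecture-24833 --as helper` (count-neutral, closes no socket).  GENERIC quadratic `E ∕ F`, one finite place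
`v` of `F`, `δ ∈ E ∖ 0`, ANY continuous `ψ` of conductor exponent `m`, ANY Haar `μ` on `F_v`.

WHY (the divisor count).  ★ FILE A `exists_entire_localWhittaker` bounds the local continuation by `(q_v^{−a} + c_δ^{−1∕2})·2(n+1)`, which is `2·2(n+1)` at a place `v ∉ S_δ` (`a = 0`, `c_δ = 1`):
multiplied over the `ξ`-dependent set `S(η)` this would cost a factor `2^{#S(η)}`, i.e. the divisor function of `ξ`, on top of ★ #1b p858401's product bound `∏ 2(n_v+1) ≤ C·(1+‖ξ_∞‖)^{2[F:ℚ]}`.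
Off `S_δ` the local factor is `P_v = max(1,‖t‖)²` (★ p858204) and ★ p858310 W2-fin gives the SHARP bound `2(n+1)` (`norm_closedForm_le`); this file merges the two into one package with the
bound **`B_v · 2(n+1)`, `B_v := if (‖δ‖_w = 1 ∀ w ∣ v ∧ a = 0) then 1 else q_v^{−a} + c_δ^{−1∕2}`** — so `∏_{v ∈ S(η)} B_v ≤ ∏_{v ∈ S_δ} max(1, B_v)` is a CONSTANT.
* §1 **`exists_entire_localWhittaker_unramified`** (`‖δ‖_w = 1 ∀ w ∣ v`): `∃ W^c` entire, `= μ(𝒪_v)⁻¹∫P_v^{−z}ψ(ηt)` on `Re z > ½` (`η ≠ 0`), `‖W^c(z)‖ ≤ 2(n+1)` for `η ∈ 𝔭^{m+n}∖𝔭^{m+n+1}`, `Re z ≥ ½`,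
  `W^c = 0` if `η ∉ 𝔭^m` (★ p858310 `integral_weight_mul_addChar_eq_closedForm` ∕ `differentiable_closedForm` ∕ `norm_closedForm_le` ∕ `…_eq_zero_of_not_mem`, ★ FILE A `ofReal_sq_cpow_neg`).
* §2 **`exists_entire_localWhittaker_sharp`**: the MERGED package with the bound `B_v·2(n+1)` (§1 in the unramified branch, ★ FILE A otherwise).
* §3 finite-idele bookkeeping for the assembly: `normAbs` of the components of a finite idele is `(q_v⁻¹)^{o_v}` with `o_v = 0` for almost all `v` (`exists_int_normAbs_apply_eq_of_mul_eq_one`,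
  `eventually_normAbs_apply_eq_one_of_mul_eq_one`), and the ball dictionary `x·u ∈ 𝔭^j ↔ x ∈ 𝔭^{j−o}` (`mul_mem_primePowBall_iff_of_normAbs_eq`).
HONEST LABEL: HC_CM is proved only modulo the 7 printed citations (2 remaining named inputs: hLiu418 = `stmt-HodgeConjecture-24832`, h413 = `stmt-HodgeConjecture-24833`) until rung 0
closes; this file asserts no named fact and closes no socket; count-neutral.

## References
* [Tate1950] J. Tate, *Fourier analysis in number fields and Hecke's zeta-functions* (1950), §2.5.
* [Casselman1980] W. Casselman, *The unramified principal series of p-adic groups I*, Compositio Math. 40 (1980), §3.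
* [Garrett2018] P. Garrett, *Modern Analysis of Automorphic Forms by Example* 1 (2018), §2.8 (divisor-type bounds for Fourier coefficients).
-/

set_option autoImplicit false
set_option linter.dupNamespace false -- the mandated namespace repeats `HodgeConjecture.HodgeConjecture`

noncomputable section

open MeasureTheory Filter Topology Set NumberField IsDedekindDomain IsDedekindDomain.HeightOneSpectrum
open scoped NNReal ENNReal Classical
open Literature.NumberTheory.GaloisRepresentations.IsNonarchimedeanLocalField
open Literature.NumberTheory.Automorphic Literature.NumberTheory.Automorphic.LocalFieldHaar
open Summit.HodgeConjecture.HodgeConjecture.Cruxes.H413.K2E1FiniteWhittakerStepSymbolLine (prod_min_one_pos)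
open Summit.HodgeConjecture.HodgeConjecture.Cruxes.H413.K2E1FiniteWhittakerPolynomial (integral_weight_mul_addChar_eq_closedForm integral_weight_mul_addChar_eq_zero_of_not_mem differentiable_closedForm norm_closedForm_le)
open Summit.HodgeConjecture.HodgeConjecture.Cruxes.H413.K2E1IntertwiningLocalFactorU2Line (prod_extension_max_one_eq_sq)
open Summit.HodgeConjecture.HodgeConjecture.Cruxes.H413.K2E1LocalWhittakerContinuationU2

namespace Summit.HodgeConjecture.HodgeConjecture.Cruxes.H413.K2E1LocalWhittakerPackageU2

/-! ## §1 The sharp package off `S_δ` -/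

section Local

variable {F E : Type} [Field F] [NumberField F] [Field E] [NumberField E] [Algebra F E] [Algebra.IsQuadraticExtension F E] {δ : E} (v : HeightOneSpectrum (𝓞 F))
  [MeasurableSpace (v.adicCompletion F)] [BorelSpace (v.adicCompletion F)] (μ : Measure (v.adicCompletion F)) [μ.IsAddHaarMeasure]

/-- **THE SHARP PACKAGE AT A PLACE WITH `‖δ‖_w = 1` FOR ALL `w ∣ v`** (so `P_v = max(1,‖t‖)²` ★): for `ψ` continuous of conductor exponent `m` and every `η` there is `W^c : ℂ → ℂ` ENTIRE with
(i) `η ≠ 0 ⟹ μ(𝒪_v)⁻¹·∫ P_v(t)^{−z}ψ(ηt) dμ = W^c(z)` on `Re z > ½`; (ii) `η ∈ 𝔭^{m+n} ∖ 𝔭^{m+n+1} ⟹ ‖W^c(z)‖ ≤ 2(n+1)` on `Re z ≥ ½`; (iii) `η ∉ 𝔭^m ⟹ W^c = 0` (★ p858310 closed form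
`(1 − q^{−2z})·Σ_{k≤n}(q^{1−2z})^k`, entire, bounded by `2(n+1)`). [cite: Tate1950, §2.5] [cite: Casselman1980, §3] -/
theorem exists_entire_localWhittaker_unramified (hv : (∀ w : v.Extension (𝓞 E), normAbs (w.1.adicCompletion E) ((algebraMap E (FiniteAdeleRing (𝓞 E) E) δ) w.1) = 1))
    {ψ : AddChar (v.adicCompletion F) Circle} (hψ : Continuous ψ) {m : ℤ} (hm : ψ.HasConductorExp m) (η : v.adicCompletion F) :
    ∃ Wc : ℂ → ℂ, Differentiable ℂ Wc ∧
      (η ≠ 0 → ∀ z : ℂ, 1 / 2 < z.re → (μ (v.adicCompletionIntegers F : Set (v.adicCompletion F))).toReal⁻¹ • ∫ t, ((((((letI := Extension.fintype (𝓞 F) F E (𝓞 E) v; ∏ w : v.Extension (𝓞 E), max 1 (normAbs (w.1.adicCompletion E) (Extension.adicCompletionSemialgHom F E w t) * normAbs (w.1.adicCompletion E) ((algebraMap E (FiniteAdeleRing (𝓞 E) E) δ) w.1))) : ℝ≥0) : ℝ) : ℝ) : ℂ) ^ (-z)) * ((ψ (η * t) : Circle) : ℂ) ∂μ = Wc z)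 ∧
      (∀ n : ℕ, η ∈ primePowBall (v.adicCompletion F) (m + n) → η ∉ primePowBall (v.adicCompletion F) (m + n + 1) →
        ∀ z : ℂ, 1 / 2 ≤ z.re → ‖Wc z‖ ≤ 2 * ((n : ℝ) + 1)) ∧
      (η ∉ primePowBall (v.adicCompletion F) m → Wc = 0) := by
  have hμ0 : 0 < μ.real (primePowBall (v.adicCompletion F) 0) := measureReal_primePowBall_pos μ 0
  -- the integrand in ★ p858310's bytes
  have hpt : ∀ (z : ℂ) (t : v.adicCompletion F), ((((((letI := Extension.fintype (𝓞 F) F E (𝓞 E) v; ∏ w : v.Extension (𝓞 E), max 1 (normAbs (w.1.adicCompletion E) (Extension.adicCompletionSemialgHom F E w t) * normAbs (w.1.adicCompletion E) ((algebraMap E (FiniteAdeleRing (𝓞 E) E) δ) w.1))) : ℝ≥0) : ℝ) : ℝ) : ℂ) ^ (-z)) * ((ψ (η * t) : Circle) : ℂ) =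
      (((max 1 ((normAbs (v.adicCompletion F) t : ℝ≥0) : ℝ) : ℝ) : ℂ) ^ (-(2 * z))) * ((ψ (t * η) : Circle) : ℂ) := by
    intro z t
    rw [prod_extension_max_one_eq_sq (E := E) v hv t, mul_comm η, NNReal.coe_pow, NNReal.coe_max, NNReal.coe_one,
      ofReal_sq_cpow_neg (lt_of_lt_of_le one_pos (le_max_left _ _)) z]
  by_cases hsupp : η ∈ primePowBall (v.adicCompletion F) m
  · by_cases hη : η = 0
    · refine ⟨0, differentiable_const 0, fun h => (h hη).elim, fun n _ hn1 => ?_, fun _ => rfl⟩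
      exact (hn1 (hη ▸ zero_mem_primePowBall _)).elim
    · obtain ⟨n₀, hn₀, hn₀'⟩ := exists_nat_mem_primePowBall_not_mem hη hsupp
      refine ⟨fun z => (μ.real (primePowBall (v.adicCompletion F) 0) : ℂ)⁻¹ * ((μ.real (primePowBall (v.adicCompletion F) 0) : ℂ) *
          ((1 - (residueFieldCard (v.adicCompletion F) : ℂ) ^ (-(2 * z))) *
            ∑ k ∈ Finset.range (n₀ + 1), ((residueFieldCard (v.adicCompletion F) : ℂ) ^ (-(2 * z)) * (residueFieldCard (v.adicCompletion F) : ℂ)) ^ k)), ?_, fun _ z hz => ?_,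
        fun n hn hn1 z hz => ?_, fun h => (h hsupp).elim⟩
      · exact (differentiable_const _).mul (differentiable_closedForm (F := v.adicCompletion F) _ n₀)
      · simp_rw [hpt z]
        rw [toReal_measure_integers_eq, integral_weight_mul_addChar_eq_closedForm μ hψ hm hn₀ hn₀' hz, Complex.real_smul, Complex.ofReal_inv]
      · have hnn : n = n₀ := nat_unique_of_mem_primePowBall_not_mem hn hn1 hn₀ hn₀'
        subst hnn
        have hS := norm_closedForm_le (F := v.adicCompletion F) hμ0.le n hz
        rw [norm_mul, norm_inv, Complex.norm_real, Real.norm_of_nonneg hμ0.le]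
        calc (μ.real (primePowBall (v.adicCompletion F) 0))⁻¹ * ‖((μ.real (primePowBall (v.adicCompletion F) 0) : ℂ) *
              ((1 - (residueFieldCard (v.adicCompletion F) : ℂ) ^ (-(2 * z))) *
                ∑ k ∈ Finset.range (n + 1), ((residueFieldCard (v.adicCompletion F) : ℂ) ^ (-(2 * z)) * (residueFieldCard (v.adicCompletion F) : ℂ)) ^ k))‖
            ≤ (μ.real (primePowBall (v.adicCompletion F) 0))⁻¹ * (2 * (n + 1) * μ.real (primePowBall (v.adicCompletion F) 0)) :=
              mul_le_mul_of_nonneg_left hS (inv_nonneg.2 hμ0.le)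
          _ = 2 * ((n : ℝ) + 1) := by field_simp
  · refine ⟨0, differentiable_const 0, fun _ z hz => ?_, fun n hn _ => (hsupp (primePowBall_antitone (by omega) hn)).elim, fun _ => rfl⟩
    simp_rw [hpt z]
    rw [integral_weight_mul_addChar_eq_zero_of_not_mem μ hψ hm hsupp hz, smul_zero]
    rfl

/-! ## §2 The merged package with the bound `B_v · 2(n+1)` -/

/-- **ONE PACKAGE PER PLACE, SHARP OFF `S_δ`.**  Data: `δ ≠ 0`, base-ball letter `a` (`ha`), `ψ` continuous of conductor exponent `m`, Haar `μ`, any `η`.  There is `W^c : ℂ → ℂ` ENTIRE with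
(i) `η ≠ 0 ⟹ μ(𝒪_v)⁻¹·∫ P_v(t)^{−z}ψ(ηt) dμ = W^c(z)` (`Re z > ½`); (ii) `η ∈ 𝔭^{m−a+n} ∖ 𝔭^{m−a+n+1} ⟹ ‖W^c(z)‖ ≤ B_v·2(n+1)` (`Re z ≥ ½`) with
**`B_v = if (‖δ‖_w = 1 ∀ w ∣ v ∧ a = 0) then 1 else q_v^{−a} + c_δ^{−1∕2}`**; (iii) `η ∉ 𝔭^{m−a} ⟹ W^c = 0` (§1 in the first branch, ★ FILE A `exists_entire_localWhittaker` in the second).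
[cite: Tate1950, §2.5] [cite: Garrett2018, §2.8] -/
theorem exists_entire_localWhittaker_sharp (hδ : δ ≠ 0) {a : ℤ}
    (ha : ∀ (w : v.Extension (𝓞 E)) (t : v.adicCompletion F), t ∈ primePowBall (v.adicCompletion F) a → normAbs (w.1.adicCompletion E) (Extension.adicCompletionSemialgHom F E w t) * normAbs (w.1.adicCompletion E) ((algebraMap E (FiniteAdeleRing (𝓞 E) E) δ) w.1) ≤ 1)
    {ψ : AddChar (v.adicCompletion F) Circle} (hψ : Continuous ψ) {m : ℤ} (hm : ψ.HasConductorExp m) (η : v.adicCompletion F) :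
    ∃ Wc : ℂ → ℂ, Differentiable ℂ Wc ∧
      (η ≠ 0 → ∀ z : ℂ, 1 / 2 < z.re → (μ (v.adicCompletionIntegers F : Set (v.adicCompletion F))).toReal⁻¹ • ∫ t, ((((((letI := Extension.fintype (𝓞 F) F E (𝓞 E) v; ∏ w : v.Extension (𝓞 E), max 1 (normAbs (w.1.adicCompletion E) (Extension.adicCompletionSemialgHom F E w t) * normAbs (w.1.adicCompletion E) ((algebraMap E (FiniteAdeleRing (𝓞 E) E) δ) w.1))) : ℝ≥0) : ℝ) : ℝ) : ℂ) ^ (-z)) * ((ψ (η * t) : Circle) : ℂ) ∂μ = Wc z) ∧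
      (∀ n : ℕ, η ∈ primePowBall (v.adicCompletion F) (m - a + n) → η ∉ primePowBall (v.adicCompletion F) (m - a + n + 1) →
        ∀ z : ℂ, 1 / 2 ≤ z.re → ‖Wc z‖ ≤ (if (∀ w : v.Extension (𝓞 E), normAbs (w.1.adicCompletion E) ((algebraMap E (FiniteAdeleRing (𝓞 E) E) δ) w.1) = 1) ∧ a = 0 then (1 : ℝ) else ((residueFieldCard (v.adicCompletion F) : ℝ) ^ (-a) + (((letI := Extension.fintype (𝓞 F) F E (𝓞 E) v; ∏ w : v.Extension (𝓞 E), min 1 (normAbs (w.1.adicCompletion E) ((algebraMap E (FiniteAdeleRing (𝓞 E) E) δ) w.1))) : ℝ≥0) : ℝ) ^ (-(1 / 2 : ℝ)))) * (2 * ((n : ℝ) + 1))) ∧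
      (η ∉ primePowBall (v.adicCompletion F) (m - a) → Wc = 0) := by
  by_cases hgood : (∀ w : v.Extension (𝓞 E), normAbs (w.1.adicCompletion E) ((algebraMap E (FiniteAdeleRing (𝓞 E) E) δ) w.1) = 1) ∧ a = 0
  · obtain ⟨hv, ha0⟩ := hgood
    subst ha0
    obtain ⟨Wc, hd, hi, hb, hz0⟩ := exists_entire_localWhittaker_unramified v μ hv hψ hm η
    refine ⟨Wc, hd, hi, fun n hn hn1 z hz => ?_, fun h => hz0 (by rwa [sub_zero] at h)⟩
    rw [if_pos ⟨hv, rfl⟩, one_mul]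
    exact hb n (by rwa [sub_zero] at hn) (by rwa [sub_zero] at hn1) z hz
  · obtain ⟨Wc, hd, hi, hb, hz0⟩ := exists_entire_localWhittaker v μ hδ ha hψ hm η
    refine ⟨Wc, hd, hi, fun n hn hn1 z hz => ?_, hz0⟩
    rw [if_neg hgood]
    exact hb n hn hn1 z hz

omit [MeasurableSpace (v.adicCompletion F)] [BorelSpace (v.adicCompletion F)] [Algebra.IsQuadraticExtension F E] in
/-- `0 < B_v`. [folklore] -/
theorem localBoundConst_pos (hδ : δ ≠ 0) (a : ℤ) : (0 : ℝ) < (if (∀ w : v.Extension (𝓞 E), normAbs (w.1.adicCompletion E) ((algebraMap E (FiniteAdeleRing (𝓞 E) E) δ) w.1) = 1) ∧ a = 0 then (1 : ℝ) else ((residueFieldCard (v.adicCompletion F) : ℝ) ^ (-a) + (((letI := Extension.fintype (𝓞 F) F E (𝓞 E) v; ∏ w : v.Extension (𝓞 E), min 1 (normAbs (w.1.adicCompletion E) ((algebraMap E (FiniteAdeleRing (𝓞 E) E) δ) w.1))) : ℝ≥0) : ℝ) ^ (-(1 / 2 : ℝ)))) := by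
  split_ifs with h
  · exact one_pos
  · have hc0 : (0 : ℝ) < (((letI := Extension.fintype (𝓞 F) F E (𝓞 E) v; ∏ w : v.Extension (𝓞 E), min 1 (normAbs (w.1.adicCompletion E) ((algebraMap E (FiniteAdeleRing (𝓞 E) E) δ) w.1))) : ℝ≥0) : ℝ) := by exact_mod_cast prod_min_one_pos v hδ
    have hqpos : (0 : ℝ) < residueFieldCard (v.adicCompletion F) := by exact_mod_cast Nat.pos_of_ne_zero (residueFieldCard_ne_zero (v.adicCompletion F))
    exact add_pos (zpow_pos hqpos _) (Real.rpow_pos_of_pos hc0 _)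

end Local

/-! ## §3 Finite-idele bookkeeping: local norms of a finite idele, the ball dictionary -/

section Idele

variable {F : Type} [Field F] [NumberField F]

/-- The components of a finite idele are non-zero: `u_v ≠ 0` when `u·u' = 1`. [folklore] -/
theorem apply_ne_zero_of_mul_eq_one {u u' : FiniteAdeleRing (𝓞 F) F} (h : u * u' = 1) (v : HeightOneSpectrum (𝓞 F)) : u v ≠ 0 := by
  intro h0
  have h1 : (u * u') v = (1 : FiniteAdeleRing (𝓞 F) F) v := by rw [h]
  rw [show (u * u') v = u v * u' v from rfl, h0, zero_mul] at h1
  exact zero_ne_one h1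

/-- **`‖u_v‖_v = (q_v⁻¹)^{o_v}` for an integer `o_v`** (components of a finite idele are non-zero; ★ `exists_normAbs_eq_inv_zpow`). [folklore] -/
theorem exists_int_normAbs_apply_eq {u u' : FiniteAdeleRing (𝓞 F) F} (h : u * u' = 1) (v : HeightOneSpectrum (𝓞 F)) :
    ∃ o : ℤ, normAbs (v.adicCompletion F) (u v) = (residueFieldCard (v.adicCompletion F) : ℝ≥0)⁻¹ ^ o :=
  exists_normAbs_eq_inv_zpow (apply_ne_zero_of_mul_eq_one h v)

/-- **`‖u_v‖_v = 1` for almost every `v`**: `u` and `u'` are integral at almost every place, and `‖u_v‖·‖u'_v‖ = 1`. [folklore] -/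
theorem eventually_normAbs_apply_eq_one {u u' : FiniteAdeleRing (𝓞 F) F} (h : u * u' = 1) :
    ∀ᶠ v : HeightOneSpectrum (𝓞 F) in cofinite, normAbs (v.adicCompletion F) (u v) = 1 := by
  filter_upwards [u.2, u'.2] with v hu hu'
  have h1 : normAbs (v.adicCompletion F) (u v) ≤ 1 := by
    have hm := (mem_primePowBall_zero_iff (u v)).2 hu
    rwa [mem_primePowBall_iff, zpow_zero] at hm
  have h2 : normAbs (v.adicCompletion F) (u' v) ≤ 1 := by
    have hm := (mem_primePowBall_zero_iff (u' v)).2 hu'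
    rwa [mem_primePowBall_iff, zpow_zero] at hm
  have hprod : normAbs (v.adicCompletion F) (u v) * normAbs (v.adicCompletion F) (u' v) = 1 := by
    rw [← map_mul, show u v * u' v = (u * u') v from rfl, h]
    exact map_one _
  refine le_antisymm h1 ?_
  calc (1 : ℝ≥0) = normAbs (v.adicCompletion F) (u v) * normAbs (v.adicCompletion F) (u' v) := hprod.symm
    _ ≤ normAbs (v.adicCompletion F) (u v) * 1 := mul_le_mul' le_rfl h2
    _ = _ := mul_one _

/-- **The ball dictionary under multiplication by a unit of known norm**: if `‖u‖ = (q⁻¹)^o` then `x·u ∈ 𝔭^j ↔ x ∈ 𝔭^{j−o}`. [folklore] -/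
theorem mul_mem_primePowBall_iff_of_normAbs_eq {K : Type*} [Field K] [ValuativeRel K] [TopologicalSpace K] [IsNonarchimedeanLocalField K]
    {u : K} {o : ℤ} (hu : normAbs K u = (residueFieldCard K : ℝ≥0)⁻¹ ^ o) (x : K) (j : ℤ) :
    x * u ∈ primePowBall K j ↔ x ∈ primePowBall K (j - o) := by
  have hq0 : (0 : ℝ≥0) < (residueFieldCard K : ℝ≥0)⁻¹ := inv_residueFieldCard_pos
  rw [mem_primePowBall_iff, mem_primePowBall_iff, map_mul, hu, zpow_sub₀ hq0.ne', div_eq_mul_inv]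
  exact (le_mul_inv_iff₀ (zpow_pos hq0 _)).symm

end Idele

end Summit.HodgeConjecture.HodgeConjecture.Cruxes.H413.K2E1LocalWhittakerPackageU2

end
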